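import Summits.QuantumAdvantage.QuantumAdvantage.Theorems.CubicForrelationNearExactIsExactCubicFormFrameK
import Summits.QuantumAdvantage.QuantumAdvantage.Theorems.CubicForrelationNearExactIsExactCubicFormRadical
import Summits.QuantumAdvantage.QuantumAdvantage.Theorems.CubicForrelationNearExactIsExactTwelveOddWeightLight

/-!
# Crux `CubicForrelation.NearExactIsExact` (stmt-QuantumAdvantage-14043) — frames from INDEPENDENT parity forms; independence from the size
  of the joint kernel; dual families

Certificate seat `b2b-cforr-cert` (gen 41).  HONEST FRAMING: kernel-checked linear algebra over `𝔽₂` (Mathlib + the tree's counting;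
standard axioms), complementing …CubicFormFrameK: there the frame needs a DUAL FAMILY as input; here (i) linear independence of the
`𝔽₂`-images suffices (`tcl_frame_of_li`, `tcl_dual_of_li` — the duals are columns of the frame), and (ii) independence follows from
counting the joint kernel: `#{x : ⟨x,zᵢ⟩ = 0 ∀ i} · 2^k = 2^N` (`tcl_li_of_kernel_card`; always `≥`, `tcl_kernel_card_ge`).  Use: the six
forms of the exceptional light cell `T ⊕ T′` (…KtThreeExceptionalStructure: the two supports meet in `2^{m−6}` points).  Nothing about
`θ₁₂`; NOT summit progress.

References: folklore linear algebra.  Axioms: the standard three.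
-/

set_option linter.dupNamespace false -- D-0017: single-problem summit ⇒ `QuantumAdvantage.QuantumAdvantage` by design

namespace Summit.QuantumAdvantage.QuantumAdvantage.Theorems.CubicForrelation.NearExactIsExact

open Finset Module
open Literature.Computability.QuantumComplexity.BuzetChailloux (bxor zeroVec bxor_comm bxor_self bxor_zeroVec zeroVec_bxor
  bxor_bxor_cancel_left)

/-- **Frame from independent forms.**  If the `𝔽₂`-images of the parity forms `z₀,…,z_{k−1}` on `k + m` bits are linearly independent, there
are `P, Pi` with `P Pi = Pi P = 1` and `⟨P y, zᵢ⟩ = yᵢ`. [folklore] -/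
theorem tcl_frame_of_li {k m : ℕ} (z : Fin k → (Fin (k + m) → Bool))
    (hli : LinearIndependent (ZMod 2) (fun i j => if z i j = true then (1 : ZMod 2) else 0)) :
    ∃ P Pi : Fin (k + m) → Fin (k + m) → ZMod 2,
      (∀ ψ ω, (∑ φ, P ψ φ * Pi φ ω) = if ψ = ω then 1 else 0) ∧
      (∀ ψ ω, (∑ φ, Pi ψ φ * P φ ω) = if ψ = ω then 1 else 0) ∧
      (∀ (i : Fin k) (y : Fin (k + m) → Bool),
        decide (Odd #(univ.filter fun j =>
          (fun ψ => decide ((∑ φ, P ψ φ * (if y φ = true then (1 : ZMod 2) else 0)) = 1)) j && z i j)) = y (Fin.castAdd m i)) := by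
  classical
  have hpar : ∀ x w : Fin (k + m) → Bool, decide (Odd #(univ.filter fun j => x j && w j)) =
      decide ((∑ j, (if x j = true then (1 : ZMod 2) else 0) * (if w j = true then (1 : ZMod 2) else 0)) = 1) := by
    intro x w
    have hs : (∑ j, (if x j = true then (1 : ZMod 2) else 0) * (if w j = true then (1 : ZMod 2) else 0)) =
        ((#(univ.filter fun j => x j && w j) : ℕ) : ZMod 2) := by
      rw [Finset.natCast_card_filter]
      refine sum_congr rfl fun j _ => ?_
      cases x j <;> cases w j <;> simp
    refine decide_eq_decide.mpr ?_
    rw [hs, ZMod.natCast_eq_one_iff_odd]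
  set ζ : Fin k → (Fin (k + m) → ZMod 2) := fun i j => if z i j = true then 1 else 0 with hζ
  have hdim : k + m ≤ finrank (ZMod 2) (Fin (k + m) → ZMod 2) := by rw [finrank_fin_fun]
  obtain ⟨q, hq, hqζ⟩ := tcg_extend ζ hli m hdim
  set Q : Matrix (Fin (k + m)) (Fin (k + m)) (ZMod 2) := Matrix.of fun ψ φ => q ψ φ with hQ
  have hrow : Q.row = q := by funext ψ φ; rfl
  have hQu : IsUnit Q := Matrix.linearIndependent_rows_iff_isUnit.mp (by rw [hrow]; exact hq)
  have hdet : IsUnit Q.det := (Matrix.isUnit_iff_isUnit_det Q).mp hQu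
  have hQQi : Q * Q⁻¹ = 1 := Matrix.mul_nonsing_inv Q hdet
  have hQiQ : Q⁻¹ * Q = 1 := Matrix.nonsing_inv_mul Q hdet
  refine ⟨fun ψ φ => Q⁻¹ ψ φ, fun ψ φ => Q ψ φ, fun ψ ω => ?_, fun ψ ω => ?_, fun i y => ?_⟩
  · have := congrFun (congrFun hQiQ ψ) ω
    rw [Matrix.mul_apply, Matrix.one_apply] at this
    exact this
  · have := congrFun (congrFun hQQi ψ) ω
    rw [Matrix.mul_apply, Matrix.one_apply] at this
    exact this
  · rw [hpar]
    have hread : ∀ t : ZMod 2, (if decide (t = 1) = true then (1 : ZMod 2) else 0) = t := by decide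
    simp only [hread]
    set y' : Fin (k + m) → ZMod 2 := fun φ => if y φ = true then 1 else 0 with hy'
    have hval : (∑ j, (∑ φ, Q⁻¹ j φ * y' φ) * ζ i j) = y' (Fin.castAdd m i) := by
      have h1 : ∀ j, ζ i j = Q (Fin.castAdd m i) j := by
        intro j; rw [hQ, Matrix.of_apply, hqζ i]
      simp only [h1]
      have h2 : (∑ j, (∑ φ, Q⁻¹ j φ * y' φ) * Q (Fin.castAdd m i) j) = ((Q * Q⁻¹).mulVec y') (Fin.castAdd m i) := by
        rw [← Matrix.mulVec_mulVec]
        simp only [Matrix.mulVec, dotProduct]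
        exact sum_congr rfl fun j _ => mul_comm _ _
      rw [h2, hQQi, Matrix.one_mulVec]
    have hval' : (∑ j, (∑ φ, Q⁻¹ j φ * (if y φ = true then (1 : ZMod 2) else 0)) * (if z i j = true then (1 : ZMod 2) else 0)) =
        if y (Fin.castAdd m i) = true then 1 else 0 := hval
    rw [hval']
    cases y (Fin.castAdd m i) <;> decide

/-- **Dual family from independence**: the vectors `uᵢ = P eᵢ` of `tcl_frame_of_li` satisfy `⟨uᵢ, z_{i'}⟩ = [i = i']`. [folklore] -/
theorem tcl_dual_of_li {k m : ℕ} (z : Fin k → (Fin (k + m) → Bool))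
    (hli : LinearIndependent (ZMod 2) (fun i j => if z i j = true then (1 : ZMod 2) else 0)) :
    ∃ u : Fin k → (Fin (k + m) → Bool), ∀ i i', decide (Odd #(univ.filter fun j => u i j && z i' j)) = decide (i = i') := by
  obtain ⟨P, Pi, -, -, hfr⟩ := tcl_frame_of_li z hli
  refine ⟨fun i => fun ψ => decide ((∑ φ, P ψ φ * (if (fun l => decide (l = Fin.castAdd m i)) φ = true then (1 : ZMod 2) else 0)) = 1),
    fun i i' => ?_⟩
  rw [hfr i' (fun l => decide (l = Fin.castAdd m i))]
  by_cases h : i = i'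
  · subst h; simp
  · rw [decide_eq_false (fun e => h (Fin.castAdd_inj.mp e).symm), decide_eq_false h]

/-- **A parity condition at most halves an xor-closed set.** [folklore] -/
theorem tcl_half_or_all {N : ℕ} (S : Finset (Fin N → Bool)) (hS : ∀ x ∈ S, ∀ y ∈ S, bxor x y ∈ S) (z : Fin N → Bool) :
    #S ≤ 2 * #(S.filter fun x => decide (Odd #(univ.filter fun j => x j && z j)) = false) := by
  classical
  by_cases hex : ∃ s₀ ∈ S, decide (Odd #(univ.filter fun j => s₀ j && z j)) = true
  · obtain ⟨s₀, hs₀, hz⟩ := hex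
    obtain ⟨-, h2⟩ := tce_half S s₀ (fun x => decide (Odd #(univ.filter fun j => x j && z j))) (fun x hx => hS x hx s₀ hs₀)
      (fun x _ => by rw [tow_parity_bxor, hz, Bool.xor_true])
    omega
  · push Not at hex
    have : (S.filter fun x => decide (Odd #(univ.filter fun j => x j && z j)) = false) = S :=
      filter_true_of_mem fun x hx => by simpa using hex x hx
    rw [this]; omega

/-- **The joint kernel of a set `T` of parity forms has at least `2^{N−#T}` elements**: `#{x : ⟨x,zᵢ⟩ = 0 ∀ i ∈ T} · 2^{#T} ≥ 2^N`.
[folklore] -/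
theorem tcl_kernel_card_ge {N : ℕ} {ι : Type*} (z : ι → (Fin N → Bool)) (T : Finset ι) :
    2 ^ N ≤ #(univ.filter fun x : Fin N → Bool => ∀ i ∈ T, decide (Odd #(univ.filter fun j => x j && z i j)) = false) * 2 ^ #T := by
  classical
  induction T using Finset.induction_on with
  | empty =>
    have : (univ.filter fun x : Fin N → Bool => ∀ i ∈ (∅ : Finset ι), decide (Odd #(univ.filter fun j => x j && z i j)) = false) =
        univ := by ext x; simp
    rw [this, card_univ, Fintype.card_fun, Fintype.card_bool, Fintype.card_fin, card_empty, pow_zero, mul_one]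
  | insert a T ha ih =>
    set S := univ.filter fun x : Fin N → Bool => ∀ i ∈ T, decide (Odd #(univ.filter fun j => x j && z i j)) = false with hSdef
    have hSadd : ∀ x ∈ S, ∀ y ∈ S, bxor x y ∈ S := by
      intro x hx y hy
      refine mem_filter.2 ⟨mem_univ _, fun i hi => ?_⟩
      rw [tow_parity_bxor, (mem_filter.1 hx).2 i hi, (mem_filter.1 hy).2 i hi]; rfl
    have hle := tcl_half_or_all S hSadd (z a)
    have hS' : (S.filter fun x => decide (Odd #(univ.filter fun j => x j && z a j)) = false) =
        univ.filter fun x : Fin N → Bool => ∀ i ∈ insert a T, decide (Odd #(univ.filter fun j => x j && z i j)) = false := by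
      ext x
      simp only [mem_filter, mem_univ, true_and, hSdef, mem_insert, forall_eq_or_imp]
      tauto
    rw [hS'] at hle
    rw [card_insert_of_notMem ha, pow_succ]
    calc 2 ^ N ≤ #S * 2 ^ #T := ih
      _ ≤ (2 * #(univ.filter fun x : Fin N → Bool => ∀ i ∈ insert a T,
            decide (Odd #(univ.filter fun j => x j && z i j)) = false)) * 2 ^ #T := Nat.mul_le_mul_right _ hle
      _ = _ := by ring

/-- **Independence from the size of the joint kernel**: if `#{x : ⟨x,zᵢ⟩ = 0 ∀ i} · 2^k = 2^N` then the `𝔽₂`-images of the forms are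
linearly independent (a dependency would make one condition redundant, and `k − 1` conditions leave `≥ 2^{N−k+1}` solutions). [folklore] -/
theorem tcl_li_of_kernel_card {N k : ℕ} (z : Fin k → (Fin N → Bool))
    (hcard : #(univ.filter fun x : Fin N → Bool => ∀ i, decide (Odd #(univ.filter fun j => x j && z i j)) = false) * 2 ^ k = 2 ^ N) :
    LinearIndependent (ZMod 2) (fun i j => if z i j = true then (1 : ZMod 2) else 0) := by
  classical
  rw [Fintype.linearIndependent_iff]
  intro g hg
  by_contra hne
  push Not at hne
  obtain ⟨i₀, hi₀⟩ := hne
  have hg1 : g i₀ = 1 := by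
    have : ∀ t : ZMod 2, t ≠ 0 → t = 1 := by decide
    exact this _ hi₀
  -- the condition `i₀` follows from the others
  have hpar : ∀ x w : Fin N → Bool, decide (Odd #(univ.filter fun j => x j && w j)) =
      decide ((∑ j, (if x j = true then (1 : ZMod 2) else 0) * (if w j = true then (1 : ZMod 2) else 0)) = 1) := by
    intro x w
    have hs : (∑ j, (if x j = true then (1 : ZMod 2) else 0) * (if w j = true then (1 : ZMod 2) else 0)) =
        ((#(univ.filter fun j => x j && w j) : ℕ) : ZMod 2) := by
      rw [Finset.natCast_card_filter]
      refine sum_congr rfl fun j _ => ?_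
      cases x j <;> cases w j <;> simp
    refine decide_eq_decide.mpr ?_
    rw [hs, ZMod.natCast_eq_one_iff_odd]
  have h01 : ∀ t : ZMod 2, decide (t = 1) = false ↔ t = 0 := by decide
  have hdep : ∀ x : Fin N → Bool, (∀ i, i ≠ i₀ → decide (Odd #(univ.filter fun j => x j && z i j)) = false) →
      decide (Odd #(univ.filter fun j => x j && z i₀ j)) = false := by
    intro x hx
    rw [hpar, h01]
    have hx' : ∀ i, i ≠ i₀ → (∑ j, (if x j = true then (1 : ZMod 2) else 0) * (if z i j = true then (1 : ZMod 2) else 0)) = 0 := by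
      intro i hi; have := hx i hi; rw [hpar, h01] at this; exact this
    have e := congrArg (fun v : Fin N → ZMod 2 => ∑ j, (if x j = true then (1 : ZMod 2) else 0) * v j) hg
    simp only [Finset.sum_apply, Pi.smul_apply, smul_eq_mul, Pi.zero_apply, mul_zero, sum_const_zero] at e
    rw [show (∑ j, (if x j = true then (1 : ZMod 2) else 0) * ∑ c, g c * (if z c j = true then (1 : ZMod 2) else 0)) =
        ∑ c, g c * ∑ j, (if x j = true then (1 : ZMod 2) else 0) * (if z c j = true then (1 : ZMod 2) else 0) by
      simp only [mul_sum]; rw [sum_comm]; exact sum_congr rfl fun c _ => sum_congr rfl fun j _ => by ring] at e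
    rw [← Finset.sum_erase_add _ _ (mem_univ i₀)] at e
    rw [sum_eq_zero (fun c hc => by rw [hx' c (ne_of_mem_erase hc), mul_zero]), zero_add, hg1, one_mul] at e
    exact e
  -- so the kernel of all forms contains the kernel of the others, which is too big
  obtain ⟨K', hK', hge0⟩ : ∃ K' : Finset (Fin N → Bool),
      (∀ x, x ∈ K' ↔ ∀ i ∈ univ.erase i₀, decide (Odd #(univ.filter fun j => x j && z i j)) = false) ∧
      2 ^ N ≤ #K' * 2 ^ #(univ.erase i₀) :=
    ⟨_, fun x => by simp only [mem_filter, mem_univ, true_and], tcl_kernel_card_ge z (univ.erase i₀)⟩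
  have hsub : K' ⊆ univ.filter fun x : Fin N → Bool => ∀ i, decide (Odd #(univ.filter fun j => x j && z i j)) = false := by
    intro x hx
    have hx' := (hK' x).1 hx
    refine mem_filter.2 ⟨mem_univ _, fun i => ?_⟩
    by_cases hi : i = i₀
    · rw [hi]; exact hdep x fun i' hi' => hx' i' (mem_erase.2 ⟨hi', mem_univ _⟩)
    · exact hx' i (mem_erase.2 ⟨hi, mem_univ _⟩)
  have hge := hge0.trans (Nat.mul_le_mul_right _ (card_le_card hsub))
  rw [card_erase_of_mem (mem_univ i₀), card_univ, Fintype.card_fin] at hge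
  have hk : 0 < k := Fin.pos i₀
  have hpow : 2 ^ k = 2 ^ (k - 1) * 2 := by rw [← pow_succ]; congr 1; omega
  have hpos : 0 < #(univ.filter fun x : Fin N → Bool => ∀ i, decide (Odd #(univ.filter fun j => x j && z i j)) = false) :=
    card_pos.2 ⟨zeroVec, mem_filter.2 ⟨mem_univ _, fun i => by simp [zeroVec]⟩⟩
  rw [hpow, ← mul_assoc] at hcard
  have : 0 < 2 ^ (k - 1) := by positivity
  nlinarith

end Summit.QuantumAdvantage.QuantumAdvantage.Theorems.CubicForrelation.NearExactIsExact
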